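import Mathlib
import Summits.Ventures.PercRepro2.Defs
import Summits.Ventures.PercRepro2.Graph
import Summits.Ventures.PercRepro2.OneColourSwitch
import Summits.Ventures.PercRepro2.RegionHubSign
import Summits.Ventures.PercRepro2.SideSwitch
import Summits.Ventures.PercRepro2.TermSwitchDefs
import Summits.Ventures.PercRepro2.TermSwitchReach
import Summits.Ventures.PercRepro2.M9NoPocketDefs
import Summits.Ventures.PercRepro2.M9NoPocketWorldD
import Summits.Ventures.PercRepro2.M9Unreached
import Summits.Ventures.PercRepro2.M9GeneralDSplit
import Summits.Ventures.PercRepro2.M9GeneralDHD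
import Summits.Ventures.PercRepro2.M9LinkedHD
import Summits.Ventures.PercRepro2.M9SubcubeHarris
import Summits.Ventures.PercRepro2.M9ClusterFibreHarris
import Summits.Ventures.PercRepro2.M9ClusterAvoidHarris
import Summits.Ventures.PercRepro2.M9PocketUnitFibre
import Summits.Ventures.PercRepro2.M9PocketUnitFibreSum
import Summits.Ventures.PercRepro2.M9PocketUnitKonly

/-!
# THEOREM: the single-`d` statement on the class without free blocks (blind cell PercRepro2,
p3 g39, 2026-08-29; `proofs/P3-GENERALD.md` §2 CONJECTURE HD on the class of
`proofs/P3-POCKETRK.md` §8, pockets allowed)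

The general single-`d` statement reduces to the hub–dead-end sum (`M9GeneralDSplit`:
`dSignSum ≤ hdSum`), and `hdSum` is twice its `K`-half by the colour flip
(`hdSum_eq_two_mul_hdK`).  Under the hypothesis **NO FREE BLOCK** — at every `K`-only legal
point the `W`-world of `{r, s}` in `G − d` is `{r, s}` (`NoFreeBlock`) — the `K`-half is the
hub–dead-end part of `M9PocketUnitKonly` with the trivial predicate, hence non-positive
(`hdK_nonpos`), and

**`dSignSum ≤ 0` for every graph with no `T`-edge, no edge inside `{r, s}` and no free block,
pockets allowed** (`dSignSum_nonpos_of_noFreeBlock`).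

A graph-level sufficient condition: every neighbour of `r` or `s` other than `r, s, d` is a
neighbour of `d` (`noFreeBlock_of_nbrs_adj_d`) — the single-vertex blocks of
`proofs/P3-POCKETRK.md` §8 — giving `dSignSum_nonpos_of_nbrs_adj_d`.  The proof bypasses the
conjecture `(RK)` of the paper: the lane's three-terminal theorem (`TermSwitchReach`) pays the
doubly reached points together with the clean one-sided points, and the exploration-fibre
Harris (`M9PocketUnitFibreSum`) pays the dead and dirty points.  Own work; std axioms.
-/

namespace Summit.Ventures.PercRepro2

namespace NoPocket

open Finset Classical OneColourSwitch SideSwitch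

variable {V : Type*} {E : Type*}

section Flip

variable [Fintype E] [DecidableEq E] {ends : E → Sym2 V} {p q r s d : V}

/-- **The hub–dead-end sum is twice its `K`-half**: the colour flip exchanges the `HD` points
with `d ∈ K₂` and those with `d ∈ M₂`, keeping `σ_pq · σ_rs`. -/
theorem hdSum_eq_two_mul_hdK :
    hdSum ends p q r s d =
      2 * ∑ ω : Config E, if HD ends p q r s d ω ∧ d ∈ K2 ends r s ω then
        sigma ends ω p q * sigma ends ω r s else 0 := by
  -- split `HD` by the status of `d`
  have hsplit : hdSum ends p q r s d =
      (∑ ω : Config E, if HD ends p q r s d ω ∧ d ∈ K2 ends r s ω then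
        sigma ends ω p q * sigma ends ω r s else 0) +
      ∑ ω : Config E, if HD ends p q r s d ω ∧ d ∈ M2 ends r s ω then
        sigma ends ω p q * sigma ends ω r s else 0 := by
    unfold hdSum
    rw [← Finset.sum_add_distrib]
    refine Finset.sum_congr rfl fun ω _ => ?_
    by_cases h : HD ends p q r s d ω
    · obtain ⟨_, _, hone, _⟩ := hd_iff_dzero.1 h
      rcases hone with ⟨hK, hM⟩ | ⟨hM, hK⟩
      · rw [if_pos h, if_pos ⟨h, hK⟩, if_neg (fun h' => hM h'.2), add_zero]
      · rw [if_pos h, if_neg (fun h' => hK h'.2), if_pos ⟨h, hM⟩, zero_add]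
    · rw [if_neg h, if_neg (fun h' => h h'.1), if_neg (fun h' => h h'.1), add_zero]
  -- the colour flip: the `M`-half equals the `K`-half
  have hflip : (∑ ω : Config E, if HD ends p q r s d ω ∧ d ∈ M2 ends r s ω then
      sigma ends ω p q * sigma ends ω r s else 0) =
      ∑ ω : Config E, if HD ends p q r s d ω ∧ d ∈ K2 ends r s ω then
        sigma ends ω p q * sigma ends ω r s else 0 := by
    refine Fintype.sum_equiv complPerm _ _ (fun ω => ?_)
    simp only [complPerm, Function.Involutive.coe_toPerm]
    rw [HD_compl, K2_compl, sigma_compl_eq_neg, sigma_compl_eq_neg, neg_mul_neg]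
  rw [hsplit, hflip, two_mul]

end Flip

section NoFree

variable [Fintype E] [DecidableEq E] {ends : E → Sym2 V} {p q r s d : V}

/-- **The `K`-half of the hub–dead-end sum is non-positive** when no `K`-only legal point has
a `W`-side vertex in `G − d` (no free block). -/
theorem hdK_nonpos (hdr : d ≠ r) (hds : d ≠ s)
    (hrs : within ends ({r, s} : Set V) = ∅) (hT : ∀ e, ends e ≠ s(d, r) ∧ ends e ≠ s(d, s))
    (hfree : ∀ ω : Config E, sep2 ends p q r s ω → DOne ends r s d ω → d ∈ K2 ends r s ω →
      d ∉ M2 ends r s ω → ∀ x ∈ M2 (endsD ends d) r s ω, x = r ∨ x = s) :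
    (∑ ω : Config E, if HD ends p q r s d ω ∧ d ∈ K2 ends r s ω then
      sigma ends ω p q * sigma ends ω r s else 0) ≤ 0 := by
  have key := sum_konly_HD_noWside_nonpos (p := p) (q := q) hdr hds hrs hT (fun _ => True)
    (fun _ _ _ _ _ => trivial)
  refine le_trans (le_of_eq (Finset.sum_congr rfl fun ω _ => ?_)) key
  by_cases h : HD ends p q r s d ω ∧ d ∈ K2 ends r s ω
  · have hB : ∀ x ∈ M2 (endsD ends d) r s ω, x = r ∨ x = s := by
      obtain ⟨hsep, hD, hK, hM, _⟩ := HD_konly_iff.1 h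
      exact hfree ω hsep hD hK hM
    rw [if_pos h, if_pos ⟨h.1, h.2, hB, trivial⟩]
  · rw [if_neg h, if_neg (fun h' => h ⟨h'.1, h'.2.1⟩)]

/-- **THE SINGLE-`d` STATEMENT ON THE CLASS WITHOUT FREE BLOCKS**: for a non-mark `d` with no
`T`-edge, no edge inside `{r, s}`, and no `W`-side vertex of `G − d` at any `K`-only legal
point, `Σ_{Sep ∧ DOne} σ_pq · σ_rs ≤ 0` — pockets allowed. -/
theorem dSignSum_nonpos_of_noFreeBlock [Fintype V] [DecidableEq V] (hdr : d ≠ r) (hds : d ≠ s)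
    (hrs : within ends ({r, s} : Set V) = ∅) (hT : ∀ e, ends e ≠ s(d, r) ∧ ends e ≠ s(d, s))
    (hfree : ∀ ω : Config E, sep2 ends p q r s ω → DOne ends r s d ω → d ∈ K2 ends r s ω →
      d ∉ M2 ends r s ω → ∀ x ∈ M2 (endsD ends d) r s ω, x = r ∨ x = s) :
    dSignSum ends p q r s d ≤ 0 := by
  refine dSignSum_nonpos_of_hdSum_nonpos hdr.symm hds.symm ?_
  rw [hdSum_eq_two_mul_hdK]
  have := hdK_nonpos (p := p) (q := q) hdr hds hrs hT hfree
  omega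

end NoFree

section Nbrs

variable {ends : E → Sym2 V} {p q r s d : V}

/-- **A graph-level sufficient condition for «no free block»**: if every neighbour of `r` or
`s` other than `r, s, d` is a neighbour of `d`, then at every `K`-only legal point the
`W`-world of `{r, s}` in `G − d` is `{r, s}` — a `W`-side vertex would give, through its
first vertex `x` (a neighbour of `r` or `s`), an edge from `d` to `x` that is either `Y`
(then `x` is doubly reached) or `W` (then `d` is `W`-reached). -/
lemma noFreeBlock_of_nbrs_adj_d (hdr : d ≠ r) (hds : d ≠ s)
    (hnb : ∀ e x, (ends e = s(r, x) ∨ ends e = s(s, x)) → x ≠ r → x ≠ s → x ≠ d →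
      ∃ e', ends e' = s(d, x)) :
    ∀ ω : Config E, sep2 ends p q r s ω → DOne ends r s d ω → d ∈ K2 ends r s ω →
      d ∉ M2 ends r s ω → ∀ x ∈ M2 (endsD ends d) r s ω, x = r ∨ x = s := by
  intro ω _ hD hK hM x hx
  have key : ∀ t, (t = r ∨ t = s) → Conn (endsD ends d) (OneColourSwitch.compl ω) t x →
      x ∈ {z | z = r ∨ z = s} := by
    intro t ht hc
    refine mem_of_conn_of_closed ?_ ht hc
    rintro a ha b hab
    obtain ⟨_, had, hbd, e, he, hends⟩ := openGraph_endsD_adj.1 hab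
    by_contra hb
    simp only [Set.mem_setOf_eq, not_or] at hb
    -- `b` is a neighbour of `r` or `s` other than `r, s, d`: it has an edge to `d`
    have hab' : ends e = s(r, b) ∨ ends e = s(s, b) := by
      rcases ha with rfl | rfl
      · exact Or.inl hends
      · exact Or.inr hends
    obtain ⟨e', he'⟩ := hnb e b hab' hb.1 hb.2 hbd
    -- `b` is `W`-reached from `r` or `s` in `G`
    have hbM : b ∈ M2 ends r s ω := by
      have hab'' : Conn ends (OneColourSwitch.compl ω) a b := conn_of_openAdj ⟨e, he, hends⟩
      rcases ha with rfl | rfl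
      · exact mem_M2_iff.2 (Or.inl hab'')
      · exact mem_M2_iff.2 (Or.inr hab'')
    cases h' : ω e'
    · -- a `W` edge from `d` to `b`: `d` would be `W`-reached
      exact hM (mem_M2_of_closed hbM h' (by rw [he', Sym2.eq_swap]))
    · -- a `Y` edge from `d` to `b`: `b` would be doubly reached
      exact hD b hb.1 hb.2 hbd (mem_K2_of_open hK h' he') hbM
  rcases mem_M2_iff.1 hx with hc | hc
  · exact key r (Or.inl rfl) hc
  · exact key s (Or.inr rfl) hc

/-- **The single-`d` statement when every neighbour of `r` or `s` is a neighbour of `d`**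
(single-vertex blocks, every block joined to `d`; pockets allowed): `dSignSum ≤ 0`. -/
theorem dSignSum_nonpos_of_nbrs_adj_d [Fintype V] [DecidableEq V] [Fintype E] [DecidableEq E]
    (hdr : d ≠ r) (hds : d ≠ s)
    (hrs : within ends ({r, s} : Set V) = ∅) (hT : ∀ e, ends e ≠ s(d, r) ∧ ends e ≠ s(d, s))
    (hnb : ∀ e x, (ends e = s(r, x) ∨ ends e = s(s, x)) → x ≠ r → x ≠ s → x ≠ d →
      ∃ e', ends e' = s(d, x)) :
    dSignSum ends p q r s d ≤ 0 :=
  dSignSum_nonpos_of_noFreeBlock hdr hds hrs hT (noFreeBlock_of_nbrs_adj_d hdr hds hnb)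

end Nbrs

end NoPocket

end Summit.Ventures.PercRepro2
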